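import Summits.ABC.IUTFork.Cor312PinnedSetting
import Summits.ABC.IUTFork.Cor312IdentifiedNonVacuity
import HarnessLib

/-!
# [IUTchIII] Cor. 3.12 — the UNION-COVER bed P♮ᵤ (honest plane model), I: plane shells, integer depth, coordinates, the shell stabiliser, movers

Record-only file (D-0012; MODEL DATA + folklore lemmas, no `Prop` fact, nothing asserted about print) of the abc-iut cell (IUT REPAIR branch B,
sub-cell B3 Joshi, seat abc-iut-rp-j1 gen 4; rung LADDER-ABC:A2.RP). TAKES NO SIDE on [IUTchIII] Cor. 3.12 and no side between Mochizuki,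
Scholze–Stix, Joshi or Dupuy–Hilado.

WHY THIS BED (part I-b `Cor312UnionCoverLattice`, parts II–III `Cor312UnionCoverModel` / `Cor312UnionCoverThm311` carry the lattice calculus, the regions,
volumes, setting and proofs; the B3 cells are `Repair/CandJoshi3Union`). On EVERY bed of record the UNION level of the Joshi-shaped candidates — `Repair.CandJoshi3.LocusCovers` H_J3: «the q-pilot
region lies in the UNION of the possible images of the Θ-pilot» (S. Joshi, arXiv:2111.04890v2 §9 p. 15: the theta-values locus `Θ̃` is the smallest
Galois/Aut-stable set containing all lifts; Dupuy–Hilado's `Aut(𝓘)`-orbit, DH-II §6.2 pp. 19–20) — COINCIDES with the single-translate level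
`Repair.CandJoshi1.JoshiDominance` H_J1 (`Repair.CandJoshi3Profile`; abc-iut-rp-j1 gen 3, `plan/repair/j1/J1-CENSUS.md` §E «Open for a successor»):
all movers of record are capsule PERMUTATIONS or SCALARS, a finite resp. lattice-fixing action, and no finite union of volume-`j²·(−|log q|)`
translates covers the volume-`−|log q|` q-region. The union level needs an INFINITE group of ISOMETRIES that MIX A BASIS of the log-shell. This
part supplies exactly that, at interface level, over abc-iut-c312-7's one-place index `toyIndex` (`l⋇ = 2`):
* `plane` — the PLANE SHELLS: `log(𝒟^⊢_v) := ℚ²` (`Bool → ℚ`), log-shell the integer lattice `ℤ²`, strip-automorphisms trivial, and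
  **Ism := `stab`, the STABILISER of the log-shell** (`g(ℤ²) = ℤ²`, i.e. `GL₂(ℤ)`) — [IUTchIII] Prop. 1.2 (vi) «Ism» read as Dupuy–Hilado's
  `Aut_{ℚ_p}(K_v ; 𝓘_v)` («automorphisms of the field as a `ℚ_p`-vector space preserving the log-shell», DH-I §4.9 ch. 15 l. 88–119, display
  l. 119; DH-II §6.2 p. 20 l. 66 «`Aut(L:I)` is by definition `ℚ_p`-linear and fixes `I` as a set»), NOT as print's Galois-induced
  isometries, which abc-iut-c312-1 proved RIGID on the log-lattice (`Thm311.Real.image_eq_of_realises_of_nsmul_mem`, `Thm311RealInd2IsmScalar`: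
  no lattice shear under print's reading). This is the bed's ONE reading choice and it is the whole mechanism (part III: under the (Ind1) capsule
  permutations alone the Θ-region of P♮ᵤ is STABLE).
* `IsInt`, `Deep p k` («`p^k` divides», the integer DEPTH standing in for the `p`-adic ball `p^k𝒪`), the `2^{j+1}` COORDINATES `coord c`
  (`c : S^±_{j+1} → Bool`) of the tensor packet `(ℚ²)^{⊗(j+1)}`, elementary tensors `ePt c`, the matrix entries `ent g r b` of a plane automorphism;
* the COORDINATE CALCULUS of the indeterminacies: `coord_permute` ((Ind1) permutes the tensor factors, DH-I §4.7 ch. 14 l. 51–80), `coord_fs` (a factor- and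
  summand-wise family `⊗_i g_i` acts on the coordinates by the Kronecker matrix `∏_i (g_i)_{c i, c' i}`), `fs_symm_apply`;
* (sequel `Cor312UnionCoverLattice`, part I-b: the integral tensors `Λ_j`, the balls `p^kΛ_j`, THE CLOSURE LEMMA «⟨(Ind1)∪(Ind2)⟩ acts by lattice
  automorphisms», the `SL₂(ℤ)` movers, the last-factor (Ind2)-family and Bézout's killing row.)
HONEST SCOPE: interface-level toy; it models the MECHANISM «basis-mixing shell-stabilising (Ind2) + a co-rank-one Θ-lattice ⟹ the union of the
possible images covers», not [IUTchI] Def. 3.1 data; the Θ-region's shape in part II is NOT print-derived (its volumes are honest). No judgement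
on print; standard axioms. [claim: Mochizuki2012, status: disputed] for every IUT noun.
CITE KEYS (two papers, disambiguated once here): DH-I = T. Dupuy, A. Hilado, «The Statement of Mochizuki's Corollary 3.12 …», arXiv:2004.13228
(bib `DupuyHilado2025`, CHUNK locators of the cell's render of record: §4.7 «Formula for Ind1» ch. 14 l. 51–80 — (Ind1) permutes the tensor
factors; §4.9 «p-adic Ind2» ch. 15 l. 88–119 — the group `Aut_{ℚ_p}(K_v : 𝓘_v)`, display l. 119); DH-II = «Probabilistic Szpiro, Baby Szpiro, and
Explicit Szpiro from Mochizuki's Corollary 3.12», arXiv:2004.13108 (bib `DupuyHilado2020`, PAGE locators: §6.2 «Worst Case Scenario» pp. 19–20,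
`Aut(L:I)` p. 19 l. 25–29, p. 20 l. 66, (6.3)–(6.7) p. 20). [cite: DupuyHilado2025, §4.7 ch.14 l.51–80; §4.9 ch.15 l.88–119]
[cite: DupuyHilado2020, §6.2 pp.19–20]
v2 (abc-iut-rp-j1 gen 6, DOC-ONLY): cite keys re-keyed per referee-t DEFECT T-g8-3 (STATUS 2026-08-26T18:01:15Z) and abc-iut-rp-lit LOCATOR FLAG
L4-K1 (16:23:13Z) — v1 keyed the §4.7/§4.9 (DH-I) content to `DupuyHilado2020` (DH-II), which has no §4.7; every declaration, statement and proof
below is byte-identical to v1 (p448738).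
-/

noncomputable section

open Set

namespace Summit.ABC.IUTFork.Cor312Vol

namespace UnionWitness

open Thm311 Cor312 Cor312.Checks Cor312.IdentifiedNonVacuity Literature.IUT.LogThetaLattice

/-! ## 1. Integers and integer depth inside `ℚ` -/

/-- `q ∈ ℚ` is an INTEGER. [folklore] -/
def IsInt (q : ℚ) : Prop := ∃ n : ℤ, (n : ℚ) = q

/-- `q` has `p`-DEPTH at least `k`: `q = p^k · n` with `n ∈ ℤ` (the integer stand-in for the ball `p^k𝒪`). [folklore] -/
def Deep (p k : ℕ) (q : ℚ) : Prop := ∃ n : ℤ, q = (p : ℚ) ^ k * n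

/-- Integers are integers. [folklore] -/
theorem isInt_intCast (n : ℤ) : IsInt (n : ℚ) := ⟨n, rfl⟩

/-- `0` is an integer. [folklore] -/
theorem isInt_zero : IsInt 0 := ⟨0, Int.cast_zero⟩

/-- `1` is an integer. [folklore] -/
theorem isInt_one : IsInt 1 := ⟨1, Int.cast_one⟩

/-- Integers are closed under addition. [folklore] -/
theorem IsInt.add {q r : ℚ} (hq : IsInt q) (hr : IsInt r) : IsInt (q + r) := by
  obtain ⟨m, rfl⟩ := hq; obtain ⟨n, rfl⟩ := hr; exact ⟨m + n, Int.cast_add m n⟩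

/-- Integers are closed under multiplication. [folklore] -/
theorem IsInt.mul {q r : ℚ} (hq : IsInt q) (hr : IsInt r) : IsInt (q * r) := by
  obtain ⟨m, rfl⟩ := hq; obtain ⟨n, rfl⟩ := hr; exact ⟨m * n, Int.cast_mul m n⟩

/-- Integers are closed under negation. [folklore] -/
theorem IsInt.neg {q : ℚ} (hq : IsInt q) : IsInt (-q) := by
  obtain ⟨m, rfl⟩ := hq; exact ⟨-m, Int.cast_neg m⟩

/-- Finite sums of integers are integers. [folklore] -/
theorem IsInt.sum {ι : Type} (s : Finset ι) {f : ι → ℚ} (h : ∀ i ∈ s, IsInt (f i)) : IsInt (∑ i ∈ s, f i) :=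
  Finset.sum_induction f IsInt (fun _ _ => IsInt.add) isInt_zero h

/-- Finite products of integers are integers. [folklore] -/
theorem IsInt.prod {ι : Type} (s : Finset ι) {f : ι → ℚ} (h : ∀ i ∈ s, IsInt (f i)) : IsInt (∏ i ∈ s, f i) :=
  Finset.prod_induction f IsInt (fun _ _ => IsInt.mul) isInt_one h

/-- Depth `0` means integral. [folklore] -/
theorem deep_zero_iff {p : ℕ} {q : ℚ} : Deep p 0 q ↔ IsInt q :=
  ⟨fun ⟨n, hn⟩ => ⟨n, by rw [hn, pow_zero, one_mul]⟩, fun ⟨n, hn⟩ => ⟨n, by rw [← hn, pow_zero, one_mul]⟩⟩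

/-- `0` has every depth. [folklore] -/
theorem Deep.zero (p k : ℕ) : Deep p k 0 := ⟨0, by rw [Int.cast_zero, mul_zero]⟩

/-- Depth is closed under addition. [folklore] -/
theorem Deep.add {p k : ℕ} {q r : ℚ} (hq : Deep p k q) (hr : Deep p k r) : Deep p k (q + r) := by
  obtain ⟨m, rfl⟩ := hq; obtain ⟨n, rfl⟩ := hr; exact ⟨m + n, by push_cast; ring⟩

/-- An integer multiple of a deep number is deep. [folklore] -/
theorem Deep.intMul {p k : ℕ} {c q : ℚ} (hc : IsInt c) (hq : Deep p k q) : Deep p k (c * q) := by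
  obtain ⟨m, rfl⟩ := hc; obtain ⟨n, rfl⟩ := hq; exact ⟨m * n, by push_cast; ring⟩

/-- Finite sums of deep numbers are deep. [folklore] -/
theorem Deep.sum {p k : ℕ} {ι : Type} (s : Finset ι) {f : ι → ℚ} (h : ∀ i ∈ s, Deep p k (f i)) : Deep p k (∑ i ∈ s, f i) :=
  Finset.sum_induction f (Deep p k) (fun _ _ => Deep.add) (Deep.zero p k) h

/-- Deeper is deep: depth `k` implies depth `k'` for `k' ≤ k`. [folklore] -/
theorem Deep.mono {p k k' : ℕ} {q : ℚ} (hq : Deep p k q) (hk : k' ≤ k) : Deep p k' q := by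
  obtain ⟨n, rfl⟩ := hq
  refine ⟨(p : ℤ) ^ (k - k') * n, ?_⟩
  push_cast
  rw [← mul_assoc, ← pow_add, Nat.add_sub_cancel' hk]

/-- A deep number is an integer. [folklore] -/
theorem Deep.isInt {p k : ℕ} {q : ℚ} (hq : Deep p k q) : IsInt q :=
  deep_zero_iff.1 (hq.mono (Nat.zero_le k))

/-- `p^k · q` has depth `k` for an integer `q`. [folklore] -/
theorem deep_pow_mul {p k : ℕ} {q : ℚ} (hq : IsInt q) : Deep p k ((p : ℚ) ^ k * q) := by
  obtain ⟨n, rfl⟩ := hq; exact ⟨n, rfl⟩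

/-- `p^k` has depth `k`. [folklore] -/
theorem deep_pow_self (p k : ℕ) : Deep p k ((p : ℚ) ^ k) := ⟨1, by rw [Int.cast_one, mul_one]⟩

/-- **`p^k` has depth `k'` iff `k' ≤ k`** (`p ≥ 2`): the balls `p^k𝒪` are STRICTLY nested. [folklore] -/
theorem deep_pow_iff {p : ℕ} (hp : 2 ≤ p) {k k' : ℕ} : Deep p k' ((p : ℚ) ^ k) ↔ k' ≤ k := by
  refine ⟨fun ⟨n, hn⟩ => ?_, fun h => (deep_pow_self p k).mono h⟩
  by_contra hlt
  obtain ⟨d, rfl⟩ := Nat.exists_eq_add_of_lt (not_le.1 hlt)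
  have hp0 : (p : ℚ) ≠ 0 := by exact_mod_cast (show p ≠ 0 by omega)
  have h1 : (p : ℚ) ^ k * 1 = (p : ℚ) ^ k * ((p : ℚ) ^ (d + 1) * n) := by
    rw [mul_one, ← mul_assoc, ← pow_add]; exact hn
  have h2 : (1 : ℚ) = (p : ℚ) ^ (d + 1) * n := mul_left_cancel₀ (pow_ne_zero k hp0) h1
  have h3 : (1 : ℤ) = (p : ℤ) ^ (d + 1) * n := by exact_mod_cast h2
  have h4 : (p : ℤ) ∣ 1 := ⟨(p : ℤ) ^ d * n, by rw [h3]; ring⟩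
  have h5 : (p : ℤ) = 1 := Int.eq_one_of_dvd_one (by positivity) h4
  omega

/-! ## 2. The plane shells: `log(𝒟^⊢_v) := ℚ²`, log-shell `ℤ²`, Ism the stabiliser of the log-shell -/

/-- The basis vector `δ_b` of the plane `ℚ² = (Bool → ℚ)`. [folklore] -/
def bvec (b : Bool) : Bool → ℚ := fun r => if b = r then 1 else 0

/-- The vector of the plane with components `a` (at `false`) and `b` (at `true`). [folklore] -/
def vec2 (a b : ℚ) : Bool → ℚ := fun r => cond r b a

/-- The MATRIX ENTRY `(g)_{r,b} = (g δ_b)_r` of a plane automorphism. [folklore] -/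
def ent (g : (Bool → ℚ) ≃ₗ[ℚ] (Bool → ℚ)) (r b : Bool) : ℚ := g (bvec b) r

/-- A plane automorphism acts through its matrix: `(g y)_r = Σ_b y_b · (g)_{r,b}`. [folklore] -/
theorem apply_eq_sum (g : (Bool → ℚ) ≃ₗ[ℚ] (Bool → ℚ)) (y : Bool → ℚ) (r : Bool) : g y r = ∑ b, y b * ent g r b := by
  have h := LinearMap.pi_apply_eq_sum_univ (g : (Bool → ℚ) →ₗ[ℚ] (Bool → ℚ)) y
  have h' := congrFun h r
  rw [LinearEquiv.coe_coe, Finset.sum_apply] at h'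
  rw [h']
  exact Finset.sum_congr rfl fun b _ => by rw [Pi.smul_apply, smul_eq_mul]; rfl

/-- **The STABILISER of the log-shell `ℤ² ⊆ ℚ²`**: the plane automorphisms `g` with `g y ∈ ℤ² ↔ y ∈ ℤ²` (`= GL₂(ℤ)`) — the bed's reading of
«Ism» ([IUTchIII] Prop. 1.2 (vi)) as Dupuy–Hilado's `Aut_{ℚ_p}(K_v : 𝓘_v)` (DH-I §4.9, display ch. 15 l. 119; DH-II §6.2 p. 19 l. 25–29).
[claim: Mochizuki2012, status: disputed] [cite: DupuyHilado2025, §4.9 ch.15 l.88–119] [cite: DupuyHilado2020, §6.2 pp.19–20] -/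
def stab : Set ((Bool → ℚ) ≃ₗ[ℚ] (Bool → ℚ)) := {g | ∀ y : Bool → ℚ, (∀ r, IsInt (g y r)) ↔ ∀ r, IsInt (y r)}

/-- The identity stabilises the log-shell. [folklore] -/
theorem refl_mem_stab : LinearEquiv.refl ℚ (Bool → ℚ) ∈ stab := fun _ => Iff.rfl

/-- The stabiliser is closed under inverses. [folklore] -/
theorem symm_mem_stab {g : (Bool → ℚ) ≃ₗ[ℚ] (Bool → ℚ)} (hg : g ∈ stab) : g.symm ∈ stab := fun y => by
  have h := hg (g.symm y)
  rw [LinearEquiv.apply_symm_apply] at h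
  exact h.symm

/-- The basis vectors are integral. [folklore] -/
theorem isInt_bvec (b r : Bool) : IsInt (bvec b r) := by
  unfold bvec; split_ifs
  · exact isInt_one
  · exact isInt_zero

/-- An element of the stabiliser has INTEGER matrix entries. [folklore] -/
theorem isInt_ent {g : (Bool → ℚ) ≃ₗ[ℚ] (Bool → ℚ)} (hg : g ∈ stab) (r b : Bool) : IsInt (ent g r b) :=
  (hg (bvec b)).2 (isInt_bvec b) r

/-- An automorphism with integer matrix and integer inverse matrix stabilises the log-shell. [folklore] -/
theorem mem_stab_of_isInt {g : (Bool → ℚ) ≃ₗ[ℚ] (Bool → ℚ)} (h : ∀ r b, IsInt (ent g r b)) (h' : ∀ r b, IsInt (ent g.symm r b)) :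
    g ∈ stab := fun y => by
  constructor
  · intro hy r
    rw [← LinearEquiv.symm_apply_apply g y, apply_eq_sum]
    exact IsInt.sum _ fun b _ => (hy b).mul (h' r b)
  · intro hy r
    rw [apply_eq_sum]
    exact IsInt.sum _ fun b _ => (hy b).mul (h r b)

/-- **The PLANE SHELLS over `toyIndex`**: `log(𝒟^⊢_v) := ℚ²`, log-shell `ℤ²`, trivial strip-automorphisms, Ism := the stabiliser `stab` of the
log-shell. (An `abbrev`, so that the carrier reduces to `Bool → ℚ`.) [claim: Mochizuki2012, status: disputed] -/
abbrev plane : LogShells toyIndex where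
  carrier := fun _ => Bool → ℚ
  shell := fun _ => {y | ∀ r, IsInt (y r)}
  stripAut := fun _ => {LinearEquiv.refl ℚ (Bool → ℚ)}
  ism := fun _ => stab
  one_mem_stripAut := fun _ => rfl
  one_mem_ism := fun _ => refl_mem_stab

/-- The point of the (one-point) fibre over the place. [folklore] -/
def fib0 (vQ : toyIndex.VQ) : toyIndex.Fibre vQ := ⟨(), rfl⟩

/-- Every point of a fibre is `fib0`. [folklore] -/
theorem eq_fib0 {vQ : toyIndex.VQ} (v : toyIndex.Fibre vQ) : v = fib0 vQ := by
  haveI := toyFibreUnique vQ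
  exact Subsingleton.elim _ _

/-! ## 3. Coordinates of the tensor packets `(ℚ²)^{⊗(j+1)}` and the coordinate calculus of the indeterminacies -/

/-- The COORDINATE FUNCTIONAL of the `(j+1)`-packet indexed by `c : S^±_{j+1} → Bool`: `x_0 ⊗ ⋯ ⊗ x_j ↦ ∏_i (x_i)_{c i}`. [folklore] -/
def coord (j : toyIndex.Label) (vQ : toyIndex.VQ) (c : toyIndex.Caps j → Bool) : plane.Packet j vQ →ₗ[ℚ] ℚ :=
  PiTensorProduct.lift
    ((MultilinearMap.mkPiAlgebra ℚ (toyIndex.Caps j) ℚ).compLinearMap fun i =>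
      (LinearMap.proj (c i) : (Bool → ℚ) →ₗ[ℚ] ℚ).comp (LinearMap.proj (fib0 vQ) : plane.Packet1 vQ →ₗ[ℚ] (Bool → ℚ)))

/-- The coordinate of a pure tensor is the product of the factors' components. [folklore] -/
theorem coord_tprod (j : toyIndex.Label) (vQ : toyIndex.VQ) (c : toyIndex.Caps j → Bool) (x : toyIndex.Caps j → plane.Packet1 vQ) :
    coord j vQ c (PiTensorProduct.tprod ℚ x) = ∏ i, x i (fib0 vQ) (c i) := by
  unfold coord
  erw [PiTensorProduct.lift.tprod]
  simp only [MultilinearMap.compLinearMap_apply, MultilinearMap.mkPiAlgebra_apply]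
  rfl

/-- The ELEMENTARY TENSOR `e_c = ⊗_i δ_{c i}` (the `2^{j+1}` of them are dual to the coordinates). [folklore] -/
def ePt (j : toyIndex.Label) (vQ : toyIndex.VQ) (c : toyIndex.Caps j → Bool) : plane.Packet j vQ :=
  plane.tprod j vQ fun i _ => bvec (c i)

/-- Coordinates of elementary tensors: `coord c' e_c = [c = c']`. [folklore] -/
theorem coord_ePt (j : toyIndex.Label) (vQ : toyIndex.VQ) (c c' : toyIndex.Caps j → Bool) :
    coord j vQ c' (ePt j vQ c) = if c = c' then 1 else 0 := by
  unfold ePt LogShells.tprod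
  rw [coord_tprod]
  simp only [bvec]
  rw [Finset.prod_boole]
  simp only [Finset.mem_univ, forall_const, funext_iff]

/-- **A capsule permutation acts on the coordinates by precomposition**: `coord c (σ·x) = coord (c ∘ σ) x` (DH-I §4.7 «Formula for Ind1»,
ch. 14 l. 51–80: (Ind1) permutes the tensor factors, `σ ∈ S_{j+1}` l. 78). [folklore] [cite: DupuyHilado2025, §4.7 ch.14 l.51–80] -/
theorem coord_permute (j : toyIndex.Label) (vQ : toyIndex.VQ) (σ : Equiv.Perm (toyIndex.Caps j)) (c : toyIndex.Caps j → Bool)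
    (x : plane.Packet j vQ) : coord j vQ c (plane.permute j vQ σ x) = coord j vQ (c ∘ σ) x := by
  have h : (coord j vQ c).comp (plane.permute j vQ σ).toLinearMap = coord j vQ (c ∘ σ) := by
    apply PiTensorProduct.ext
    ext y
    simp only [LinearMap.compMultilinearMap_apply]
    show coord j vQ c (plane.permute j vQ σ (plane.tprod j vQ y)) = coord j vQ (c ∘ σ) (PiTensorProduct.tprod ℚ y)
    rw [plane.permute_tprod]
    show coord j vQ c (PiTensorProduct.tprod ℚ fun i => y (σ.symm i)) = _
    rw [coord_tprod, coord_tprod]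
    exact Fintype.prod_equiv σ.symm _ _ fun i => by rw [Function.comp_apply, Equiv.apply_symm_apply]
  exact congrArg (fun f : plane.Packet j vQ →ₗ[ℚ] ℚ => f x) h

/-- **A factor- and summand-wise family `⊗_i g_i` acts on the coordinates by the Kronecker matrix**:
`coord c (⊗_i g_i · x) = Σ_{c'} (∏_i (g_i)_{c i, c' i}) · coord c' x`. [folklore] -/
theorem coord_fs (j : toyIndex.Label) (vQ : toyIndex.VQ)
    (g : toyIndex.Caps j → ∀ v : toyIndex.Fibre vQ, plane.carrier v.1 ≃ₗ[ℚ] plane.carrier v.1)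
    (c : toyIndex.Caps j → Bool) (x : plane.Packet j vQ) :
    coord j vQ c (plane.factorwise j vQ (fun i => plane.summandwise vQ (g i)) x) =
      ∑ c' : toyIndex.Caps j → Bool, (∏ i, ent (g i (fib0 vQ)) (c i) (c' i)) * coord j vQ c' x := by
  have h : (coord j vQ c).comp (plane.factorwise j vQ (fun i => plane.summandwise vQ (g i))).toLinearMap =
      ∑ c' : toyIndex.Caps j → Bool, (∏ i, ent (g i (fib0 vQ)) (c i) (c' i)) • coord j vQ c' := by
    apply PiTensorProduct.ext
    ext y
    show coord j vQ c (plane.factorwise j vQ (fun i => plane.summandwise vQ (g i)) (plane.tprod j vQ y)) =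
      (∑ c' : toyIndex.Caps j → Bool, (∏ i, ent (g i (fib0 vQ)) (c i) (c' i)) • coord j vQ c') (plane.tprod j vQ y)
    rw [LinearMap.sum_apply, plane.factorwise_summandwise_tprod]
    simp only [LinearMap.smul_apply, smul_eq_mul]
    show coord j vQ c (PiTensorProduct.tprod ℚ fun i v => g i v (y i v)) =
      ∑ c' : toyIndex.Caps j → Bool, (∏ i, ent (g i (fib0 vQ)) (c i) (c' i)) * coord j vQ c' (PiTensorProduct.tprod ℚ y)
    rw [coord_tprod]
    simp only [coord_tprod]
    have h1 : ∀ i, g i (fib0 vQ) (y i (fib0 vQ)) (c i) = ∑ b, y i (fib0 vQ) b * ent (g i (fib0 vQ)) (c i) b :=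
      fun i => apply_eq_sum _ _ _
    simp only [h1]
    rw [Fintype.prod_sum (fun i b => y i (fib0 vQ) b * ent (g i (fib0 vQ)) (c i) b)]
    exact Finset.sum_congr rfl fun c' _ => by rw [Finset.prod_mul_distrib, mul_comm]
  have h' := congrArg (fun f : plane.Packet j vQ →ₗ[ℚ] ℚ => f x) h
  simp only [LinearMap.comp_apply, LinearEquiv.coe_coe, LinearMap.sum_apply, LinearMap.smul_apply, smul_eq_mul] at h'
  exact h'

/-- The inverse of a factor- and summand-wise family is the factor- and summand-wise family of the inverses. [folklore] -/
theorem fs_symm_apply (j : toyIndex.Label) (vQ : toyIndex.VQ)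
    (g : toyIndex.Caps j → ∀ v : toyIndex.Fibre vQ, plane.carrier v.1 ≃ₗ[ℚ] plane.carrier v.1) (x : plane.Packet j vQ) :
    (plane.factorwise j vQ (fun i => plane.summandwise vQ (g i))).symm x =
      plane.factorwise j vQ (fun i => plane.summandwise vQ (fun v => (g i v).symm)) x := by
  have h : ((plane.factorwise j vQ (fun i => plane.summandwise vQ (g i))).symm : plane.Packet j vQ →ₗ[ℚ] plane.Packet j vQ) =
      (plane.factorwise j vQ (fun i => plane.summandwise vQ (fun v => (g i v).symm)) : plane.Packet j vQ →ₗ[ℚ] plane.Packet j vQ) := by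
    apply PiTensorProduct.ext
    ext y
    simp only [LinearMap.compMultilinearMap_apply]
    show (PiTensorProduct.congr _).symm (PiTensorProduct.tprod ℚ y) = PiTensorProduct.congr _ (PiTensorProduct.tprod ℚ y)
    rw [PiTensorProduct.congr_symm_tprod, PiTensorProduct.congr_tprod]
    rfl
  exact congrArg (fun f : plane.Packet j vQ →ₗ[ℚ] plane.Packet j vQ => f x) h

end UnionWitness

end Summit.ABC.IUTFork.Cor312Vol

end
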